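/-
Copyright (c) 2026 the pub-hodgecm-mathlib formalisation cell (harness21).  Prover seat hodgecm-mathlib-K2E3-p29 (g4), Track B ∕ R90-TF, h413 = `stmt-HodgeConjecture-24833`,
R90-TF section S8 «ContSpec-n½» (S8 dealer R90-CS-plan (g3) S8-R248 (5) «T-INSTANTIATION ROW»): FILE 1 of the row — the ADDITIVITY ENGINE for the exports-WITH-(E6) clause list.
★ p864499 `exportsRow_finset_sum` adds the seven exports clauses across a finite sum of sections; the eighth clause (E6) — the truncated `L²` family off the pole set — is added here:
Arthur's truncation `Λ^T` is ADDITIVE on `U(3)` for `0 < T` on integrable data (★ `borelConstantTerm_finset_sum`; the pseudo-Eisenstein sum of the constant-term tail is a genuine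
finite sum at rank 3, ★ `finite_support_constantTermTail_translate`), the `𝓕`-translates of a continuous section are integrable (`𝓕` relatively compact, `ν` Haar), and `L²` classes add
almost everywhere.  With it, ★ p864499 §6.2's τ-row «exports at every `K_∞`-finite τ-admissible generator from the exports at PURE blocks» is re-run WITH (E6), in the binder bytes of ★
p864638 §3 `hCONT_tauRow_of_truncatedExportsRow`'s hypothesis `hTEXP6`.
-/
import Summits.HodgeConjecture.HodgeConjecture.Theorems.R90S8ResGMidExportsRowAdditiveU3   -- ★ p864499 (K2E1-p12): `exportsRow_finset_sum`, `flatSectionU_finsetSum`, `eisensteinSeriesU_finsetSum_apply`, `exists_normal_tauLevel_le`, `chiSectionSpacePair_tauLevel_mono`; brings ★ §5d pure splitting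
import Summits.HodgeConjecture.HodgeConjecture.Theorems.R90S8ResGMidHContRowsFreeU3        -- ★ p864638 (K2E1-p11): `hCONT_tauRow_of_truncatedExportsRow` (the consumer of `hTEXP6`); brings ★ `truncation`, `AdelicGroupData.quotFun`, `Lp`
import Literature.NumberTheory.Automorphic.UnitaryGroupTruncationFiniteSum                  -- ★ `finite_support_constantTermTail_translate` (rank 3, `0 < T`)
import Literature.NumberTheory.Automorphic.UnitaryGroupArthurKernelClassExpansion           -- ★ `borelConstantTerm_finset_sum`, `pseudoEisenstein_finset_sum`
import HarnessLib

/-!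
# S8 (R)′ road, T-INSTANTIATION ROW, FILE 1 — `R90S8ResGMidTruncatedExportsRowAdditiveU3`: THE EXPORTS-WITH-(E6) CLAUSE LIST IS ADDITIVE; THE `hTEXP6` τ-ROW FROM THE EXPORTS-WITH-(E6) AT PURE BLOCKS

Track B ∕ R90-TF, crux h413 = `stmt-HodgeConjecture-24833`, route of record `HCCMUnconditional`; cell `hodgecm-mathlib`, R90-TF section S8 «ContSpec-n½ ∕ ResidualSpectrum», sub-socket (R)′
(B ED. 7 :337), row `hCONT` (★ p864188 :77–:89) ← ★ p864638 §3 `hCONT_tauRow_of_truncatedExportsRow (hTEXP6)` ← `hTEXP6` = «exports WITH the truncated `L²` family (E6) at EVERY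
`K_∞`-finite τ-admissible generator, for every normalised Heisenberg package `(ν, 𝓕)`».  Tonight `hTEXP6` runs on the GAUGE road (★ p864638 §4 `…_of_gauge_blocks (hBLOCK)`, `hBLOCK`
carrying row 1's gauge letters `hfam`∕`hnc`); the τ-PORTS (★ p864413 ∕ p864428 ∕ p864481) kill the gauge letters only at PURE `K_∞`-type blocks, and a τ-admissible generator is a finite
SUM of pure-block sections (★ p864443 §5d) — so the ports road to `hTEXP6` needs the exports-with-(E6) clause list to be ADDITIVE.  That is this file (FILE 2
`R90S8ResGMidTauExportsRowOfPortsU3` composes it with the (E6)-twin of ★ p864481).  THEOREMS ONLY (no `def`, no `instance`, no `notation`, no named-fact hypothesis, no `sorry`; default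
heartbeats); lane `--supports stmt-HodgeConjecture-24833 --as helper` (count-neutral).  CLOSES NO SOCKET.  LETTER-FREE (every input is ★ or a visible binder).

THE MATHEMATICS ([Arthur1980TraceFormulaII, §1]; [Garrett2018, §2.10]; [MoeglinWaldspurger1995, I.2.13, II.1.5, IV.2.3]; [BernsteinLapid2019, Thm 2.3, §4]).  `Λ^T φ = φ − Ψ(c_B^T φ)` with
`c_B^T φ = 𝟙_{H > T}·φ_B` (★ `truncation`, ★ `constantTermTail`).  The constant term `φ_B(x) = ν(𝓕)⁻¹ ∫_𝓕 φ(u x) dν(u)` is additive on data integrable over `𝓕` (★ `borelConstantTerm_finset_sum`),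
hence so is the tail (§1); on `U(3)` and for `T > 0` the pseudo-Eisenstein sum `Ψ(c_B^T φ)(g) = Σ_{δ ∈ B(F)∖G(F)} c_B^T φ(δ g)` has FINITE support for EVERY `φ` (★
`finite_support_constantTermTail_translate`: `H(δ g) > T` for finitely many `δ`), so `Ψ` is additive there (★ `pseudoEisenstein_finset_sum`) and `Λ^T(Σᵢ φᵢ) = Σᵢ Λ^T φᵢ` (§1
`truncation_finset_sum_apply`).  A continuous `φ` has integrable `𝓕`-translates `u ↦ φ(u x)` as soon as `closure 𝓕` is compact and `ν` is finite on compacts (§1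
`integrableOn_translate_of_continuous`).  The descent `quotFun` is additive definitionally and `L²(μ)` classes add a.e. (§1), so the (E6) families of the pieces add to an (E6) family of
the sum, holomorphic off the union of the pole sets (§2 `truncatedExportsRow_finset_sum` = ★ `exportsRow_finset_sum` ⊕ (E6)).  §3 re-runs ★ p864499 §6.2 with the longer clause list:
shrink the τ-level to a normal principal one, split the generator into pure-block pieces (★ `exists_finset_sum_pure_blocks_of_isArchFinite`), export each piece WITH (E6) by the pure-block
letter `hPURE6` (quantified over the Heisenberg package, which the engine's frame carries), and add.
* §1 `constantTermTail_finset_sum_apply`, **`truncation_finset_sum_apply`** (`U(3)`, `0 < T`, integrable translates), `integrableOn_translate_of_continuous`, `quotFun_finset_sum_apply`,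
  `coeFn_finset_sum_ae` (`L²` classes), `quotFun_truncation_finset_sum` (the (E6) right-hand sides add).
* §2 **`truncatedExportsRow_finset_sum`** — the exports-with-(E6) clause list of ★ p864592 ∕ ★ p864638 is closed under finite sums (pole set `⋃ Pᵢ`, continuation `Σ Ecᵢ`, family `Σ Famᵢ`).
* §3 **`truncatedExportsTauRow_of_pureBlocks (hχ₁u) (hχ₂u) (hsum) (hPURE6)`** ⊢ ★ p864638 §3's `hTEXP6` binder BYTE FOR BYTE at the `φ_ξ`-block.
HONEST LABEL: HC_CM is proved only modulo the 7 printed citations (2 remaining named inputs: hLiu418 = `stmt-HodgeConjecture-24832`, h413 = `stmt-HodgeConjecture-24833`) until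
rung 0 closes; REL ≠ ★ ≠ BUILT; this file is an engine — `hPURE6` stays a visible letter here (FILE 2 pays it from the ports modulo `hCO′`); pays no socket; count-neutral.

## References
* [Arthur1980TraceFormulaII] J. Arthur, *A trace formula for reductive groups II*, Compositio Math. 40 (1980), §1 (the truncation operator, linearity).
* [Garrett2018] P. Garrett, *Modern Analysis of Automorphic Forms by Example*, vol. 1 (2018), §2.10 (`Λ^T f = f − Ψ(c_P^T f)`, finiteness of the tail sum).
* [MoeglinWaldspurger1995] C. Mœglin, J.-L. Waldspurger, *Spectral Decomposition and Eisenstein Series* (1995), I.2.13, II.1.5, IV.1.9–IV.1.11, IV.2.3.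
* [BernsteinLapid2019] J. Bernstein, E. Lapid, *On the meromorphic continuation of Eisenstein series*, J. Amer. Math. Soc. 37 (2024), Thm 2.3, §4.
* [BorelJacquet1979] A. Borel, H. Jacquet, *Automorphic forms and automorphic representations*, Proc. Symp. Pure Math. 33.1 (1979), §4.1.
-/

set_option autoImplicit false
set_option linter.dupNamespace false  -- the mandated namespace `…HodgeConjecture.HodgeConjecture.R90.S8` (LEAD #1 L1) repeats the summit's segment

noncomputable section

open MeasureTheory Measure Set Filter Topology NumberField ContRepresentation
open Literature.NumberTheory Literature.NumberTheory.Automorphic Literature.NumberTheory.Automorphic.UnitaryGroup Literature.NumberTheory.GaloisRepresentations AdelicGroupData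
open Literature.NumberTheory.Automorphic.Arthur2013.Leaves.TECR Literature.NumberTheory.Rogawski1990
open Summit.HodgeConjecture.HodgeConjecture.Cruxes.H413.K2E1BorelEisensteinU
open Summit.HodgeConjecture.HodgeConjecture.Cruxes.H413.K2E1CharacterEisensteinU3PairDefs
open Summit.HodgeConjecture.HodgeConjecture.Cruxes.H413.K2E1ChiSectionSpaceU3PairDefs
open scoped ENNReal NNReal

namespace Summit.HodgeConjecture.HodgeConjecture.R90.S8

/-! ## §1 Additivity of the constant-term tail, of Arthur's truncation on `U(3)`, of the descent and of `L²` classes -/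

section Generic

variable {F E : Type} [Field F] [NumberField F] [Field E] [NumberField E] [Algebra F E] {c : E ≃ₐ[F] E} {N : ℕ} [NeZero N]

/-- **THE CONSTANT-TERM TAIL OF A FINITE SUM** is the sum of the tails, at any point whose `𝓕`-translates are integrable for every summand (★ `borelConstantTerm_finset_sum`; the cut-off
`𝟙_{H > T}` is common). [cite: Garrett2018, §2.10] [cite: Arthur1980TraceFormulaII, §1] -/
theorem constantTermTail_finset_sum_apply [MeasurableSpace (adelicUnipotent F E c N)] (ν : Measure (adelicUnipotent F E c N)) (𝓕 : Set (adelicUnipotent F E c N)) (T : ℝ≥0)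
    {ι : Type*} (s : Finset ι) (φ : ι → (quasiSplit F E c N).Adelic → ℂ) (x : (quasiSplit F E c N).Adelic)
    (hφ : ∀ i ∈ s, IntegrableOn (fun u : adelicUnipotent F E c N => φ i ((u : (quasiSplit F E c N).Adelic) * x)) 𝓕 ν) :
    constantTermTail ν 𝓕 T (∑ i ∈ s, φ i) x = ∑ i ∈ s, constantTermTail ν 𝓕 T (φ i) x := by
  by_cases hx : T < borelHeight x
  · rw [constantTermTail_of_lt _ hx, borelConstantTerm_finset_sum ν 𝓕 s φ x hφ]
    exact Finset.sum_congr rfl fun i _ => (constantTermTail_of_lt _ hx).symm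
  · rw [constantTermTail_of_not_lt _ hx]
    exact (Finset.sum_eq_zero fun i _ => constantTermTail_of_not_lt _ hx).symm

/-- **ARTHUR'S TRUNCATION IS ADDITIVE ON `U(3)`** (`0 < T`): `Λ^T(Σᵢ φᵢ)(g) = Σᵢ Λ^T φᵢ(g)` whenever every `𝓕`-translate `u ↦ φᵢ(u x)` is integrable — the tail is additive (previous lemma) and
its pseudo-Eisenstein sum is a genuine FINITE sum at rank 3 for every function (★ `finite_support_constantTermTail_translate`), so ★ `pseudoEisenstein_finset_sum` applies with no further
hypothesis. [cite: Arthur1980TraceFormulaII, §1] [cite: Garrett2018, §2.10] -/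
theorem truncation_finset_sum_apply [MeasurableSpace (adelicUnipotent F E c 3)] (ν : Measure (adelicUnipotent F E c 3)) (𝓕 : Set (adelicUnipotent F E c 3)) {T : ℝ≥0} (hT : 0 < T)
    {ι : Type*} (s : Finset ι) (φ : ι → (quasiSplit F E c 3).Adelic → ℂ)
    (hφ : ∀ i ∈ s, ∀ x : (quasiSplit F E c 3).Adelic, IntegrableOn (fun u : adelicUnipotent F E c 3 => φ i ((u : (quasiSplit F E c 3).Adelic) * x)) 𝓕 ν)
    (g : (quasiSplit F E c 3).Adelic) :
    truncation ν 𝓕 T (∑ i ∈ s, φ i) g = ∑ i ∈ s, truncation ν 𝓕 T (φ i) g := by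
  have htail : constantTermTail ν 𝓕 T (∑ i ∈ s, φ i) = ∑ i ∈ s, constantTermTail ν 𝓕 T (φ i) := by
    funext x
    rw [constantTermTail_finset_sum_apply ν 𝓕 T s φ x (fun i hi => hφ i hi x), Finset.sum_apply]
  rw [truncation_def, htail, pseudoEisenstein_finset_sum s _ g (fun i _ => finite_support_constantTermTail_translate ν 𝓕 hT (φ i) g), Finset.sum_apply,
    ← Finset.sum_sub_distrib]
  exact Finset.sum_congr rfl fun i _ => (truncation_def ν 𝓕 T (φ i) g).symm

omit [NeZero N] in
/-- **THE `𝓕`-TRANSLATES OF A CONTINUOUS FUNCTION ARE INTEGRABLE**: `u ↦ φ(u x)` is `ν`-integrable on `𝓕` when `φ` is continuous, `closure 𝓕` is compact and `ν` is finite on compacts (e.g. Haar).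
[cite: MoeglinWaldspurger1995, I.2.13] -/
theorem integrableOn_translate_of_continuous [MeasurableSpace (quasiSplit F E c N).Adelic] [BorelSpace (quasiSplit F E c N).Adelic]
    (ν : Measure ↥(adelicUnipotent F E c N)) [IsFiniteMeasureOnCompacts ν] {𝓕 : Set ↥(adelicUnipotent F E c N)} (h𝓕c : IsCompact (closure 𝓕))
    {φ : (quasiSplit F E c N).Adelic → ℂ} (hφ : Continuous φ) (x : (quasiSplit F E c N).Adelic) :
    IntegrableOn (fun u : ↥(adelicUnipotent F E c N) => φ ((u : (quasiSplit F E c N).Adelic) * x)) 𝓕 ν :=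
  (((hφ.comp (continuous_subtype_val.mul continuous_const)).continuousOn).integrableOn_compact' h𝓕c isClosed_closure.measurableSet).mono_set subset_closure

end Generic

section CM

variable (L : Type) [Field L] [NumberField L] [IsCMField L]
  [MeasurableSpace (quasiSplit (↥(maximalRealSubfield L)) L (IsCMField.complexConj L) 3).Adelic] [BorelSpace (quasiSplit (↥(maximalRealSubfield L)) L (IsCMField.complexConj L) 3).Adelic]
  (μ : Measure (quasiSplit (↥(maximalRealSubfield L)) L (IsCMField.complexConj L) 3).automorphicQuotient)

omit [MeasurableSpace (quasiSplit (↥(maximalRealSubfield L)) L (IsCMField.complexConj L) 3).Adelic] [BorelSpace (quasiSplit (↥(maximalRealSubfield L)) L (IsCMField.complexConj L) 3).Adelic] in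
/-- The descent `quotFun` of a finite sum of functions is the sum of the descents (definitional linearity of ★ `AdelicGroupData.quotFun`). [cite: BorelJacquet1979, §4.1] -/
theorem quotFun_finset_sum_apply {ι : Type*} (s : Finset ι) (φ : ι → (quasiSplit (↥(maximalRealSubfield L)) L (IsCMField.complexConj L) 3).Adelic → ℂ)
    (x : (quasiSplit (↥(maximalRealSubfield L)) L (IsCMField.complexConj L) 3).automorphicQuotient) :
    (quasiSplit (↥(maximalRealSubfield L)) L (IsCMField.complexConj L) 3).quotFun (∑ i ∈ s, φ i) x = ∑ i ∈ s, (quasiSplit (↥(maximalRealSubfield L)) L (IsCMField.complexConj L) 3).quotFun (φ i) x := by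
  simp only [AdelicGroupData.quotFun, Finset.sum_apply]

omit [MeasurableSpace (quasiSplit (↥(maximalRealSubfield L)) L (IsCMField.complexConj L) 3).Adelic] [BorelSpace (quasiSplit (↥(maximalRealSubfield L)) L (IsCMField.complexConj L) 3).Adelic] in
/-- **The `L²` class of a finite sum is a.e. the sum of the classes** (`Lp.coeFn_add`, Finset induction). [folklore] [cite: MoeglinWaldspurger1995, IV.2.3] -/
theorem coeFn_finset_sum_ae {ι : Type*} (s : Finset ι) (f : ι → Lp ℂ 2 μ) :
    ((∑ i ∈ s, f i : Lp ℂ 2 μ) : (quasiSplit (↥(maximalRealSubfield L)) L (IsCMField.complexConj L) 3).automorphicQuotient → ℂ) =ᵐ[μ]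
      fun x => ∑ i ∈ s, (f i : (quasiSplit (↥(maximalRealSubfield L)) L (IsCMField.complexConj L) 3).automorphicQuotient → ℂ) x := by
  classical
  induction s using Finset.induction_on with
  | empty =>
    filter_upwards [Lp.coeFn_zero (E := ℂ) (p := 2) (μ := μ)] with x hx
    simp only [Finset.sum_empty]
    exact hx
  | insert i s hi ih =>
    rw [Finset.sum_insert hi]
    filter_upwards [Lp.coeFn_add (f i) (∑ j ∈ s, f j), ih] with x hadd hih
    rw [hadd, Pi.add_apply, hih, Finset.sum_insert hi]

/-- **THE (E6) RIGHT-HAND SIDES ADD**: `quotFun (Λ^T (Σᵢ Φᵢ)) = Σᵢ quotFun (Λ^T Φᵢ)` pointwise on the automorphic quotient, for continuous `Φᵢ`, `0 < T`, `closure 𝓕` compact and `ν` finite on compacts.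
[cite: Arthur1980TraceFormulaII, §1] [cite: MoeglinWaldspurger1995, I.2.13, IV.2.3] -/
theorem quotFun_truncation_finset_sum (ν : Measure ↥(adelicUnipotent (↥(maximalRealSubfield L)) L (IsCMField.complexConj L) 3)) [IsFiniteMeasureOnCompacts ν]
    {𝓕 : Set ↥(adelicUnipotent (↥(maximalRealSubfield L)) L (IsCMField.complexConj L) 3)} (h𝓕c : IsCompact (closure 𝓕)) {T : ℝ≥0} (hT : 0 < T)
    {ι : Type*} (s : Finset ι) (Φ : ι → (quasiSplit (↥(maximalRealSubfield L)) L (IsCMField.complexConj L) 3).Adelic → ℂ) (hΦ : ∀ i ∈ s, Continuous (Φ i))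
    (x : (quasiSplit (↥(maximalRealSubfield L)) L (IsCMField.complexConj L) 3).automorphicQuotient) :
    (quasiSplit (↥(maximalRealSubfield L)) L (IsCMField.complexConj L) 3).quotFun (truncation ν 𝓕 T (∑ i ∈ s, Φ i)) x =
      ∑ i ∈ s, (quasiSplit (↥(maximalRealSubfield L)) L (IsCMField.complexConj L) 3).quotFun (truncation ν 𝓕 T (Φ i)) x := by
  have h : truncation ν 𝓕 T (∑ i ∈ s, Φ i) = ∑ i ∈ s, truncation ν 𝓕 T (Φ i) := by
    funext g
    rw [truncation_finset_sum_apply ν 𝓕 hT s Φ (fun i hi y => integrableOn_translate_of_continuous ν h𝓕c (hΦ i hi) y) g, Finset.sum_apply]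
  rw [h, quotFun_finset_sum_apply]

/-! ## §2 The exports-with-(E6) clause list is closed under finite sums -/

/-- **§2 — `truncatedExportsRow_finset_sum`: THE EXPORTS-WITH-(E6) CLAUSE LIST IS CLOSED UNDER FINITE SUMS.**  As ★ `exportsRow_finset_sum` (continuation `Σ Ecᵢ`, pole set `⋃ Pᵢ`, tube identity,
analyticity, (E4), (E2-bd)), plus (E6): at every level `T ≥ 1` the truncated `L²` families `Famᵢ` of the pieces add to `Σ Famᵢ`, holomorphic off `⋃ Pᵢ`, whose class is a.e. `quotFun (Λ^T (Σ Ecᵢ z))`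
there (§1: `Λ^T` additive on the continuous `Ecᵢ z`, `L²` classes add a.e.).  The Heisenberg package `(ν, 𝓕)` is the row's: `ν` finite on compacts, `closure 𝓕` compact.
[cite: MoeglinWaldspurger1995, II.1.5, IV.1.9, IV.2.3] [cite: BernsteinLapid2019, Thm 2.3, §4] [cite: Arthur1980TraceFormulaII, §1] -/
theorem truncatedExportsRow_finset_sum
    (ν : Measure ↥(adelicUnipotent (↥(maximalRealSubfield L)) L (IsCMField.complexConj L) 3)) [IsFiniteMeasureOnCompacts ν]
    {𝓕 : Set ↥(adelicUnipotent (↥(maximalRealSubfield L)) L (IsCMField.complexConj L) 3)} (h𝓕c : IsCompact (closure 𝓕))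
    {ι : Type} [Fintype ι] (cf : ι → (quasiSplit (↥(maximalRealSubfield L)) L (IsCMField.complexConj L) 3).Adelic → ℂ) (Ec : ι → ℂ → (quasiSplit (↥(maximalRealSubfield L)) L (IsCMField.complexConj L) 3).Adelic → ℂ) (P : ι → Set ℂ)
    (hPc : ∀ i, IsClosed (P i)) (hPcd : ∀ i, ∀ z₀ : ℂ, ∀ᶠ s in 𝓝[≠] z₀, s ∉ P i) (hPre : ∀ i, ∀ z ∈ P i, z.re ≤ 2)
    (hE2 : ∀ i, ∀ z : ℂ, 2 < z.re → Ec i z = eisensteinSeriesU (flatSectionU (cf i) z))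
    (hEan : ∀ i g (z : ℂ), z ∉ P i → AnalyticAt ℂ (fun z => Ec i z g) z) (hE4 : ∀ i (z : ℂ), z ∉ P i → Continuous (Ec i z))
    (hEbd : ∀ i (z₁ : ℂ), z₁ ∉ P i → ∀ K : Set (quasiSplit (↥(maximalRealSubfield L)) L (IsCMField.complexConj L) 3).Adelic, IsCompact K → ∃ V ∈ 𝓝 z₁, ∃ M : ℝ, ∀ z ∈ V, ∀ g ∈ K, ‖Ec i z g‖ ≤ M)
    (hE6 : ∀ i, ∀ T : ℝ≥0, 1 ≤ T → ∃ Fam : ℂ → Lp ℂ 2 μ, DifferentiableOn ℂ Fam (P i)ᶜ ∧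
      ∀ z : ℂ, z ∉ P i → ((Fam z : Lp ℂ 2 μ) : (quasiSplit (↥(maximalRealSubfield L)) L (IsCMField.complexConj L) 3).automorphicQuotient → ℂ) =ᵐ[μ]
        (quasiSplit (↥(maximalRealSubfield L)) L (IsCMField.complexConj L) 3).quotFun (truncation ν 𝓕 T (Ec i z)))
    (hs : ∀ i (z : ℂ), 2 < z.re → ∀ g : (quasiSplit (↥(maximalRealSubfield L)) L (IsCMField.complexConj L) 3).Adelic, Summable fun q : (Quotient (MulAction.orbitRel ↥(borelU ((IsCMField.complexConj L : L ≃ₐ[↥(maximalRealSubfield L)] L) : L →+* L) ((StdForm.antidiagonal 3).over L)) ↥(unitaryGroupOfForm ((IsCMField.complexConj L : L ≃ₐ[↥(maximalRealSubfield L)] L) : L →+* L) ((StdForm.antidiagonal 3).over L)))) => flatSectionU (cf i) z (((quasiSplit (↥(maximalRealSubfield L)) L (IsCMField.complexConj L) 3).toAdelic (Quotient.out q : ↥(unitaryGroupOfForm ((IsCMField.complexConj L : L ≃ₐ[↥(maximalRealSubfield L)] L) : L →+* L) ((StdForm.antidiagonal 3).over L)))) * g)) :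
    ∃ (Ec' : ℂ → (quasiSplit (↥(maximalRealSubfield L)) L (IsCMField.complexConj L) 3).Adelic → ℂ) (P : Set ℂ), IsClosed P ∧ (∀ z₀ : ℂ, ∀ᶠ s in 𝓝[≠] z₀, s ∉ P) ∧ (∀ z ∈ P, z.re ≤ 2) ∧
        (∀ z : ℂ, 2 < z.re → Ec' z = eisensteinSeriesU (flatSectionU (∑ i, cf i) z)) ∧ (∀ g (z : ℂ), z ∉ P → AnalyticAt ℂ (fun z => Ec' z g) z) ∧
        (∀ z : ℂ, z ∉ P → Continuous (Ec' z)) ∧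
        (∀ z₁ : ℂ, z₁ ∉ P → ∀ K : Set (quasiSplit (↥(maximalRealSubfield L)) L (IsCMField.complexConj L) 3).Adelic, IsCompact K → ∃ V ∈ 𝓝 z₁, ∃ M : ℝ, ∀ z ∈ V, ∀ g ∈ K, ‖Ec' z g‖ ≤ M) ∧
        (∀ T : ℝ≥0, 1 ≤ T → ∃ Fam : ℂ → Lp ℂ 2 μ, DifferentiableOn ℂ Fam Pᶜ ∧
          ∀ z : ℂ, z ∉ P → ((Fam z : Lp ℂ 2 μ) : (quasiSplit (↥(maximalRealSubfield L)) L (IsCMField.complexConj L) 3).automorphicQuotient → ℂ) =ᵐ[μ]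
            (quasiSplit (↥(maximalRealSubfield L)) L (IsCMField.complexConj L) 3).quotFun (truncation ν 𝓕 T (Ec' z))) := by
  classical
  have hnot : ∀ {z : ℂ}, z ∉ (⋃ i, P i) → ∀ i, z ∉ P i := fun hz i h => hz (mem_iUnion.2 ⟨i, h⟩)
  refine ⟨fun z g => ∑ i, Ec i z g, ⋃ i, P i, isClosed_iUnion_of_finite hPc, fun z₀ => ?_, fun z hz => ?_, fun z hz => ?_, fun g z hz => ?_, fun z hz => ?_, fun z₁ hz₁ K hK => ?_,
    fun T hT => ?_⟩
  · exact (eventually_all.2 fun i => hPcd i z₀).mono fun s hs h => by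
      obtain ⟨i, hi⟩ := mem_iUnion.1 h
      exact hs i hi
  · obtain ⟨i, hi⟩ := mem_iUnion.1 hz
    exact hPre i z hi
  · funext g
    show ∑ i, Ec i z g = eisensteinSeriesU (flatSectionU (∑ i, cf i) z) g
    rw [flatSectionU_finsetSum, eisensteinSeriesU_finsetSum_apply L _ _ g (fun i _ => hs i z hz g)]
    exact Finset.sum_congr rfl fun i _ => by rw [hE2 i z hz]
  · have h := Finset.analyticAt_sum Finset.univ (fun i _ => hEan i g z (hnot hz i))
    rwa [Finset.sum_fn] at h
  · exact continuous_finsetSum Finset.univ fun i _ => hE4 i z (hnot hz i)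
  · choose V hV M hM using fun i => hEbd i z₁ (hnot hz₁ i) K hK
    refine ⟨⋂ i, V i, (iInter_mem).2 hV, ∑ i, M i, fun z hz g hg => (norm_sum_le _ _).trans (Finset.sum_le_sum fun i _ => hM i z (mem_iInter.1 hz i) g hg)⟩
  · -- (E6): the families of the pieces add
    have hT0 : 0 < T := one_pos.trans_le hT
    choose Fam hFd hFae using fun i => hE6 i T hT
    refine ⟨fun z => ∑ i, Fam i z, DifferentiableOn.fun_sum (u := Finset.univ) fun i _ => (hFd i).mono (compl_subset_compl.2 (subset_iUnion P i)), fun z hz => ?_⟩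
    have hall : ∀ᵐ x ∂μ, ∀ i, ((Fam i z : Lp ℂ 2 μ) : (quasiSplit (↥(maximalRealSubfield L)) L (IsCMField.complexConj L) 3).automorphicQuotient → ℂ) x =
        (quasiSplit (↥(maximalRealSubfield L)) L (IsCMField.complexConj L) 3).quotFun (truncation ν 𝓕 T (Ec i z)) x :=
      eventually_all.2 fun i => hFae i z (hnot hz i)
    have hsum : (fun g => ∑ i, Ec i z g) = ∑ i, Ec i z := by
      funext g
      rw [Finset.sum_apply]
    filter_upwards [coeFn_finset_sum_ae L μ Finset.univ (fun i => Fam i z), hall] with x hx hxi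
    rw [hx, hsum, quotFun_truncation_finset_sum L ν h𝓕c hT0 Finset.univ _ (fun i _ => hE4 i z (hnot hz i)) x]
    exact Finset.sum_congr rfl fun i _ => hxi i

/-! ## §3 HEAD: `hTEXP6` at every `K_∞`-finite τ-admissible generator, from the exports-with-(E6) at PURE blocks -/

section Head

variable (ξ : OneDimAutRepH L) (μω : HeckeCharacter L)

/-- **§3 HEAD — `truncatedExportsTauRow_of_pureBlocks`**: for the `φ_ξ`-block with unitary characters (`hχ₁u`, `hχ₂u`; ★ `isUnitary_blockChar`), the Godement letter `hsum` (★ `hSUM_of_unitary`)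
and the PURE-BLOCK EXPORTS-WITH-(E6) LETTER `hPURE6` (the exports-with-(E6) datum for every section of a pure block packaged EXACTLY as ★ §5d `exists_finset_sum_pure_blocks_of_isArchFinite`,
and for EVERY normalised Heisenberg package `(ν, 𝓕)` — Haar, inversion-invariant, `𝓕` a fundamental domain of `N(F)` with compact closure and `ν 𝓕 = 1`), the row `hTEXP6` of ★ p864638 §3
`hCONT_tauRow_of_truncatedExportsRow` holds at EVERY τ-admissible generator `(U₀, φ)` BYTE FOR BYTE: ★ p864499 §6.2's proof (normal principal sub-level, pure splitting ★ §5d, export each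
piece by `hPURE6`) with the additive clause list of §2 (`ν` Haar ⇒ finite on compacts; `0 < 1 ≤ T`). [cite: MoeglinWaldspurger1995, II.1.5, IV.1.9–IV.1.11, IV.2.3]
[cite: BernsteinLapid2019, Thm 2.3, §4] [cite: BorelJacquet1979, §4.1] [cite: Arthur1980TraceFormulaII, §1] -/
theorem truncatedExportsTauRow_of_pureBlocks (hχ₁u : ((ξ.bcη⁻¹ * ξ.bcψ⁻¹ * μω)).IsUnitary) (hχ₂u : ∀ t, ‖((ξ.ψ t : ℂˣ) : ℂ)‖ = 1)
    (hsum : ∀ φ ∈ chiSectionSpacePair (ξ.bcη⁻¹ * ξ.bcψ⁻¹ * μω) ξ.ψ (⊥ : Subgroup (quasiSplit (↥(maximalRealSubfield L)) L (IsCMField.complexConj L) 3).Adelic) ((1 : ↥(⊥ : Subgroup (quasiSplit (↥(maximalRealSubfield L)) L (IsCMField.complexConj L) 3).Adelic) →* ℂ) : ↥(⊥ : Subgroup (quasiSplit (↥(maximalRealSubfield L)) L (IsCMField.complexConj L) 3).Adelic) → ℂ), Continuous φ → ∀ z : ℂ, 2 < z.re → ∀ g : (quasiSplit (↥(maximalRealSubfield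 L)) L (IsCMField.complexConj L) 3).Adelic,
      Summable fun q : (Quotient (MulAction.orbitRel ↥(borelU ((IsCMField.complexConj L : L ≃ₐ[↥(maximalRealSubfield L)] L) : L →+* L) ((StdForm.antidiagonal 3).over L)) ↥(unitaryGroupOfForm ((IsCMField.complexConj L : L ≃ₐ[↥(maximalRealSubfield L)] L) : L →+* L) ((StdForm.antidiagonal 3).over L)))) => ‖flatSectionU φ z (((quasiSplit (↥(maximalRealSubfield L)) L (IsCMField.complexConj L) 3).toAdelic (Quotient.out q : ↥(unitaryGroupOfForm ((IsCMField.complexConj L : L ≃ₐ[↥(maximalRealSubfield L)] L) : L →+* L) ((StdForm.antidiagonal 3).over L)))) * g)‖)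
    (hPURE6 : ∀ (U₀ : Subgroup ↥(finAdelic (↥(maximalRealSubfield L)) L (IsCMField.complexConj L) 3 ((StdForm.antidiagonal 3).over L))) (_ : IsTauLevel L U₀) (V : Submodule ℂ ((quasiSplit (↥(maximalRealSubfield L)) L (IsCMField.complexConj L) 3).Adelic → ℂ)) (_ : FiniteDimensional ℂ ↥V)
      (_ : ∀ k ∈ ((standardMaximalCompactGL 3 L).comap (adelicVal (↥(maximalRealSubfield L)) L (IsCMField.complexConj L) 3 ((StdForm.antidiagonal 3).over L)) : Subgroup (quasiSplit (↥(maximalRealSubfield L)) L (IsCMField.complexConj L) 3).Adelic), ∀ ψ ∈ V, (fun x => ψ (x * k)) ∈ V) (_ : ∀ ψ ∈ V, IsChiSectionPair (ξ.bcη⁻¹ * ξ.bcψ⁻¹ * μω) ξ.ψ ψ) (_ : ∀ ψ ∈ V, Continuous ψ)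
      (_ : ∀ ψ ∈ V, ∃ M : ℝ, ∀ x, ‖ψ x‖ ≤ M) (_ : V ≤ chiSectionSpacePair (ξ.bcη⁻¹ * ξ.bcψ⁻¹ * μω) ξ.ψ (tauLevel L U₀) ((1 : ↥(tauLevel L U₀) →* ℂ) : ↥(tauLevel L U₀) → ℂ))
      (_ : ∃ hV : ∀ k : ↥((standardMaximalCompactGL 3 L).comap (adelicVal (↥(maximalRealSubfield L)) L (IsCMField.complexConj L) 3 ((StdForm.antidiagonal 3).over L)) : Subgroup (quasiSplit (↥(maximalRealSubfield L)) L (IsCMField.complexConj L) 3).Adelic), ∀ ψ ∈ V, ((rightTranslation (quasiSplit (↥(maximalRealSubfield L)) L (IsCMField.complexConj L) 3)).comp ((standardMaximalCompactGL 3 L).comap (adelicVal (↥(maximalRealSubfield L)) L (IsCMField.complexConj L) 3 ((StdForm.antidiagonal 3).over L)) : Subgroup (quasiSplit (↥(maximalRealSubfield L)) L (IsCMField.complexConj L) 3).Adelic).subtype) k ψ ∈ V, (Subrepresentation.toRepresentation (⟨V, hV⟩ : Subrepresentation ((rightTranslation (quasiSplit (↥(maximalRealSubfield L)) L (IsCMField.complexConj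 L) 3)).comp ((standardMaximalCompactGL 3 L).comap (adelicVal (↥(maximalRealSubfield L)) L (IsCMField.complexConj L) 3 ((StdForm.antidiagonal 3).over L)) : Subgroup (quasiSplit (↥(maximalRealSubfield L)) L (IsCMField.complexConj L) 3).Adelic).subtype))).IsIrreducible)
      (_ : ∃ (W₀ : Submodule ℂ ((quasiSplit (↥(maximalRealSubfield L)) L (IsCMField.complexConj L) 3).Adelic → ℂ)) (hW₀K : ∀ k : ↥(archMaximalCompact L), ∀ ψ ∈ W₀, ((rightTranslation (quasiSplit (↥(maximalRealSubfield L)) L (IsCMField.complexConj L) 3)).comp (archMaximalCompact L).subtype) k ψ ∈ W₀),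
        FiniteDimensional ℂ ↥W₀ ∧ (Subrepresentation.toRepresentation (⟨W₀, hW₀K⟩ : Subrepresentation ((rightTranslation (quasiSplit (↥(maximalRealSubfield L)) L (IsCMField.complexConj L) 3)).comp (archMaximalCompact L).subtype))).IsIrreducible ∧
        V ≤ chiSectionSpacePairKType (ξ.bcη⁻¹ * ξ.bcψ⁻¹ * μω) ξ.ψ (tauLevel L U₀) ((1 : ↥(tauLevel L U₀) →* ℂ) : ↥(tauLevel L U₀) → ℂ) (archMaximalCompact L).subtype (commute_tauLevel_archMaximalCompact L U₀) (Subrepresentation.toRepresentation (⟨W₀, hW₀K⟩ : Subrepresentation ((rightTranslation (quasiSplit (↥(maximalRealSubfield L)) L (IsCMField.complexConj L) 3)).comp (archMaximalCompact L).subtype))))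
      (ν : Measure ↥(adelicUnipotent (↥(maximalRealSubfield L)) L (IsCMField.complexConj L) 3)) (_ : ν.IsHaarMeasure) (𝓕 : Set ↥(adelicUnipotent (↥(maximalRealSubfield L)) L (IsCMField.complexConj L) 3))
      (_ : IsFundamentalDomain ↥(rationalUnipotent (↥(maximalRealSubfield L)) L (IsCMField.complexConj L) 3) 𝓕 ν) (_ : IsCompact (closure 𝓕)) (_ : ν.IsInvInvariant) (_ : ν 𝓕 = 1),
      ∀ φ ∈ V, ∃ (Ec' : ℂ → (quasiSplit (↥(maximalRealSubfield L)) L (IsCMField.complexConj L) 3).Adelic → ℂ) (P : Set ℂ), IsClosed P ∧ (∀ z₀ : ℂ, ∀ᶠ s in 𝓝[≠] z₀, s ∉ P) ∧ (∀ z ∈ P, z.re ≤ 2) ∧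
        (∀ z : ℂ, 2 < z.re → Ec' z = eisensteinSeriesU (flatSectionU φ z)) ∧ (∀ g (z : ℂ), z ∉ P → AnalyticAt ℂ (fun z => Ec' z g) z) ∧
        (∀ z : ℂ, z ∉ P → Continuous (Ec' z)) ∧
        (∀ z₁ : ℂ, z₁ ∉ P → ∀ K : Set (quasiSplit (↥(maximalRealSubfield L)) L (IsCMField.complexConj L) 3).Adelic, IsCompact K → ∃ V ∈ 𝓝 z₁, ∃ M : ℝ, ∀ z ∈ V, ∀ g ∈ K, ‖Ec' z g‖ ≤ M) ∧
        (∀ T : ℝ≥0, 1 ≤ T → ∃ Fam : ℂ → Lp ℂ 2 μ, DifferentiableOn ℂ Fam Pᶜ ∧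
          ∀ z : ℂ, z ∉ P → ((Fam z : Lp ℂ 2 μ) : (quasiSplit (↥(maximalRealSubfield L)) L (IsCMField.complexConj L) 3).automorphicQuotient → ℂ) =ᵐ[μ]
            (quasiSplit (↥(maximalRealSubfield L)) L (IsCMField.complexConj L) 3).quotFun (truncation ν 𝓕 T (Ec' z)))) :
    ∀ (U₀ : Subgroup ↥(finAdelic (↥(maximalRealSubfield L)) L (IsCMField.complexConj L) 3 ((StdForm.antidiagonal 3).over L))) (_ : IsTauLevel L U₀)
      (φ : (quasiSplit (↥(maximalRealSubfield L)) L (IsCMField.complexConj L) 3).Adelic → ℂ) (_ : φ ∈ chiSectionSpacePair (ξ.bcη⁻¹ * ξ.bcψ⁻¹ * μω) ξ.ψ (tauLevel L U₀) ((1 : ↥(tauLevel L U₀) →* ℂ) : ↥(tauLevel L U₀) → ℂ)) (_ : Continuous φ)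
      (_ : IsArchFinite L φ)
      (ν : Measure ↥(adelicUnipotent (↥(maximalRealSubfield L)) L (IsCMField.complexConj L) 3)) (_ : ν.IsHaarMeasure) (𝓕 : Set ↥(adelicUnipotent (↥(maximalRealSubfield L)) L (IsCMField.complexConj L) 3))
      (_ : IsFundamentalDomain ↥(rationalUnipotent (↥(maximalRealSubfield L)) L (IsCMField.complexConj L) 3) 𝓕 ν) (_ : IsCompact (closure 𝓕)) (_ : ν.IsInvInvariant) (_ : ν 𝓕 = 1),
      ∃ (Ec' : ℂ → (quasiSplit (↥(maximalRealSubfield L)) L (IsCMField.complexConj L) 3).Adelic → ℂ) (P : Set ℂ), IsClosed P ∧ (∀ z₀ : ℂ, ∀ᶠ s in 𝓝[≠] z₀, s ∉ P) ∧ (∀ z ∈ P, z.re ≤ 2) ∧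
        (∀ z : ℂ, 2 < z.re → Ec' z = eisensteinSeriesU (flatSectionU φ z)) ∧ (∀ g (z : ℂ), z ∉ P → AnalyticAt ℂ (fun z => Ec' z g) z) ∧
        (∀ z : ℂ, z ∉ P → Continuous (Ec' z)) ∧
        (∀ z₁ : ℂ, z₁ ∉ P → ∀ K : Set (quasiSplit (↥(maximalRealSubfield L)) L (IsCMField.complexConj L) 3).Adelic, IsCompact K → ∃ V ∈ 𝓝 z₁, ∃ M : ℝ, ∀ z ∈ V, ∀ g ∈ K, ‖Ec' z g‖ ≤ M) ∧
        (∀ T : ℝ≥0, 1 ≤ T → ∃ Fam : ℂ → Lp ℂ 2 μ, DifferentiableOn ℂ Fam Pᶜ ∧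
          ∀ z : ℂ, z ∉ P → ((Fam z : Lp ℂ 2 μ) : (quasiSplit (↥(maximalRealSubfield L)) L (IsCMField.complexConj L) 3).automorphicQuotient → ℂ) =ᵐ[μ]
            (quasiSplit (↥(maximalRealSubfield L)) L (IsCMField.complexConj L) 3).quotFun (truncation ν 𝓕 T (Ec' z))) := by
  intro U₀ hU₀ φ hφ hφc hφa ν hν 𝓕 h𝓕N h𝓕c hνi hν1
  haveI := hν
  -- a normal principal level below `U₀`; `φ` is bounded (unitary characters)
  obtain ⟨U₁, hU₁U₀, hU₁, hN⟩ := exists_normal_tauLevel_le L hU₀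
  have hφ₁ := chiSectionSpacePair_tauLevel_mono L (χ₁ := (ξ.bcη⁻¹ * ξ.bcψ⁻¹ * μω)) (χ₂ := ξ.ψ) hU₁U₀ hφ
  have hφM : ∃ M : ℝ, ∀ x, ‖φ x‖ ≤ M := exists_norm_le_of_isChiSectionPair L hχ₁u hχ₂u (isChiSectionPair_of_mem hφ) hφc
  -- split into pure blocks at the normal level `U₁`
  obtain ⟨ι, hι, V, cf, hsumφ, hc⟩ := exists_finset_sum_pure_blocks_of_isArchFinite L ξ μω hU₁ hN hφ₁ hφc hφM hφa
  -- export each piece WITH (E6) and collect the data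
  have hexp : ∀ i, ∃ (Ec' : ℂ → (quasiSplit (↥(maximalRealSubfield L)) L (IsCMField.complexConj L) 3).Adelic → ℂ) (P : Set ℂ), IsClosed P ∧ (∀ z₀ : ℂ, ∀ᶠ s in 𝓝[≠] z₀, s ∉ P) ∧ (∀ z ∈ P, z.re ≤ 2) ∧
        (∀ z : ℂ, 2 < z.re → Ec' z = eisensteinSeriesU (flatSectionU (cf i) z)) ∧ (∀ g (z : ℂ), z ∉ P → AnalyticAt ℂ (fun z => Ec' z g) z) ∧
        (∀ z : ℂ, z ∉ P → Continuous (Ec' z)) ∧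
        (∀ z₁ : ℂ, z₁ ∉ P → ∀ K : Set (quasiSplit (↥(maximalRealSubfield L)) L (IsCMField.complexConj L) 3).Adelic, IsCompact K → ∃ V ∈ 𝓝 z₁, ∃ M : ℝ, ∀ z ∈ V, ∀ g ∈ K, ‖Ec' z g‖ ≤ M) ∧
        (∀ T : ℝ≥0, 1 ≤ T → ∃ Fam : ℂ → Lp ℂ 2 μ, DifferentiableOn ℂ Fam Pᶜ ∧
          ∀ z : ℂ, z ∉ P → ((Fam z : Lp ℂ 2 μ) : (quasiSplit (↥(maximalRealSubfield L)) L (IsCMField.complexConj L) 3).automorphicQuotient → ℂ) =ᵐ[μ]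
            (quasiSplit (↥(maximalRealSubfield L)) L (IsCMField.complexConj L) 3).quotFun (truncation ν 𝓕 T (Ec' z))) := fun i => by
    obtain ⟨hcV, -, hVfd, hVK, hVχ, hVc, hVM, hVlev, hVirr, hVpure⟩ := hc i
    exact hPURE6 U₁ hU₁ (V i) hVfd hVK hVχ hVc hVM hVlev hVirr hVpure ν hν 𝓕 h𝓕N h𝓕c hνi hν1 (cf i) hcV
  choose Ec P hPc hPcd hPre hE2 hEan hE4 hEbd hE6 using hexp
  -- summability of each piece on `2 < Re` from the Godement letter (the pieces are continuous level-free pair-sections)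
  have hS : (Submodule.span ℂ (Set.range fun k : ↥((standardMaximalCompactGL 3 L).comap (adelicVal (↥(maximalRealSubfield L)) L (IsCMField.complexConj L) 3 ((StdForm.antidiagonal 3).over L)) : Subgroup (quasiSplit (↥(maximalRealSubfield L)) L (IsCMField.complexConj L) 3).Adelic) => ((rightTranslation (quasiSplit (↥(maximalRealSubfield L)) L (IsCMField.complexConj L) 3)).comp ((standardMaximalCompactGL 3 L).comap (adelicVal (↥(maximalRealSubfield L)) L (IsCMField.complexConj L) 3 ((StdForm.antidiagonal 3).over L)) : Subgroup (quasiSplit (↥(maximalRealSubfield L)) L (IsCMField.complexConj L) 3).Adelic).subtype) k φ)) ≤ chiSectionSpacePair (ξ.bcη⁻¹ * ξ.bcψ⁻¹ * μω) ξ.ψ (⊥ : Subgroup (quasiSplit (↥(maximalRealSubfield L)) L (IsCMField.complexConj L) 3).Adelic) ((1 : ↥(⊥ : Subgroup (quasiSplit (↥(maximalRealSubfield L)) L (IsCMField.complexConj L) 3).Adelic) →* ℂ) : ↥(⊥ : Subgroup (quasiSplit (↥(maximalRealSubfield L)) L (IsCMField.complexConj L) 3).Adelic) → ℂ) :=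
    span_kMaxTranslates_le_chiSectionSpacePair_bot L hφ₁
  have hs : ∀ i (z : ℂ), 2 < z.re → ∀ g : (quasiSplit (↥(maximalRealSubfield L)) L (IsCMField.complexConj L) 3).Adelic, Summable fun q : (Quotient (MulAction.orbitRel ↥(borelU ((IsCMField.complexConj L : L ≃ₐ[↥(maximalRealSubfield L)] L) : L →+* L) ((StdForm.antidiagonal 3).over L)) ↥(unitaryGroupOfForm ((IsCMField.complexConj L : L ≃ₐ[↥(maximalRealSubfield L)] L) : L →+* L) ((StdForm.antidiagonal 3).over L)))) => flatSectionU (cf i) z (((quasiSplit (↥(maximalRealSubfield L)) L (IsCMField.complexConj L) 3).toAdelic (Quotient.out q : ↥(unitaryGroupOfForm ((IsCMField.complexConj L : L ≃ₐ[↥(maximalRealSubfield L)] L) : L →+* L) ((StdForm.antidiagonal 3).over L)))) * g) := fun i z hz g => by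
    obtain ⟨hcV, hVS, -, -, -, hVc, -⟩ := hc i
    exact (hsum (cf i) (hS (hVS hcV)) (hVc (cf i) hcV) z hz g).of_norm
  rw [hsumφ]
  exact truncatedExportsRow_finset_sum L μ ν h𝓕c cf Ec P hPc hPcd hPre hE2 hEan hE4 hEbd hE6 hs

end Head

end CM

end Summit.HodgeConjecture.HodgeConjecture.R90.S8

end
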